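import Literature.Computability.AlgebraicComplexity.AsymptoticRankScalarExtension
import Mathlib.Algebra.BigOperators.Ring.Finset
import HarnessLib

/-!
# Evaluating `T_k^{⊗ m j}` through an integral decomposition of `T_k^{⊗ m}` (Pratt, Thm. 1.9)

Topic `Computability/AlgebraicComplexity`. Fifth instalment (a) of the proof of
`Literature.Computability.AlgebraicComplexity.pratt2024_thm_1_9` (K. Pratt, STOC 2024, Thm. 1.9).
Pratt: "By assumption, this evaluation [of the restriction of `T_k^{⊗r}`] can be done using
`O((R̃(T_k)+ε/2)^r)` field operations … these field operations only involve … a constant-sized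
subset of the prime field of `𝔽` arising in a rank decomposition of a fixed power of `T_k`."
The word RAM of the tree computes with natural numbers, so the decomposition is taken INTEGRAL:

* `IntDecomp k m` — an integral decomposition `D₀ · T_k^{⊗m} = ∑_{ℓ<R} α_ℓ ⊗ β_ℓ ⊗ γ_ℓ` with
  `α, β, γ` integer-valued and `D₀ ≥ 1` (denominators cleared);
* **`exists_intDecomp`** — for every `δ > 0` some power `m ≥ 1` has an integral decomposition of
  length `R < (R̃_ℂ(T_k) + δ)^m` (from the rational decompositions of
  `AsymptoticRankScalarExtension.lean`, i.e. BCS Prop. 15.17, by clearing denominators);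
* **`IntDecomp.eval_pow`** — the evaluation identity behind the algorithm: for `j` blocks and
  arbitrary integer inputs `x, y, z` indexed by `j`-tuples of indices of `T_k^{⊗m}`,
  `∑_{ℓ : [j] → [R]} X̂(ℓ) Ŷ(ℓ) Ẑ(ℓ) = D₀^j · ∑_{s,t,u} (∏_g T_k^{⊗m}(s_g,t_g,u_g)) x(s) y(t) z(u)`,
  where `X̂(ℓ) = ∑_s (∏_g α_{ℓ_g}(s_g)) x(s)` (and similarly `Ŷ`, `Ẑ`) are the three "transforms"
  the algorithm computes by `j` rounds of mode products — the `j`-th Kronecker power of the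
  decomposition evaluates `(D₀ T_k^{⊗m})^{⊗j} = D₀^j T_k^{⊗mj}`.

## References

* [Pratt2024SCC] K. Pratt, STOC 2024, arXiv:2311.02774 — §2, proof of Thm. 1.9; §1.1 (recursive
  evaluation of Kronecker powers from a rank decomposition).
* [BurgisserClausenShokrollahi1997] P. Bürgisser, M. Clausen, M. A. Shokrollahi, *Algebraic
  Complexity Theory*, Prop. (15.17) (descent to the prime field), (14.23)–(14.24)/§15.6
  (Kronecker powers of bilinear algorithms).
-/

noncomputable section

open scoped BigOperators

namespace Literature.Computability.AlgebraicComplexity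

/-! ## Integral decompositions of a power of `T_k` -/

/-- An **integral rank decomposition of `T_k^{⊗m}` with denominator `D₀`**:
`D₀ · T_k^{⊗m}(a,b,c) = ∑_{ℓ<R} α_ℓ(a) β_ℓ(b) γ_ℓ(c)` with integer vectors `α_ℓ, β_ℓ, γ_ℓ` and an
integer `D₀ ≥ 1` — the data hard-wired into Pratt's algorithm ("a rank decomposition of a fixed
power of `T_k`" over the prime field, denominators cleared). [cite: Pratt2024SCC, §2 (proof of Thm. 1.9)] -/
structure IntDecomp (k m : ℕ) where
  /-- The length of the decomposition. -/
  R : ℕ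
  /-- The cleared denominator. -/
  D₀ : ℕ
  /-- The denominator is positive. -/
  D₀_pos : 0 < D₀
  /-- First factors. -/
  α : Fin R → (Fin m → TripartitionIndex k) → ℤ
  /-- Second factors. -/
  β : Fin R → (Fin m → TripartitionIndex k) → ℤ
  /-- Third factors. -/
  γ : Fin R → (Fin m → TripartitionIndex k) → ℤ
  /-- The decomposition identity. -/
  eq : ∀ a b c, (D₀ : ℤ) * kroneckerPow (tripartitionTensor ℤ k) m a b c =
    ∑ ℓ, α ℓ a * β ℓ b * γ ℓ c

/-- Clearing one denominator: the integer `(D / q.den) · q.num`, equal to `D · q` when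
`q.den ∣ D`. [folklore] -/
def clearDen (D : ℕ) (q : ℚ) : ℤ := ((D / q.den : ℕ) : ℤ) * q.num

/-- `clearDen D q = D · q` in `ℚ` when `q.den ∣ D`. [folklore] -/
theorem cast_clearDen {D : ℕ} {q : ℚ} (h : q.den ∣ D) : ((clearDen D q : ℤ) : ℚ) = (D : ℚ) * q := by
  obtain ⟨c, hc⟩ := h
  have hden : 0 < q.den := q.den_pos
  rw [clearDen, hc, Nat.mul_div_cancel_left c hden]
  push_cast
  calc (c : ℚ) * q.num = c * (q.den * q) := by rw [Rat.den_mul_eq_num]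
    _ = (q.den * c : ℚ) * q := by ring

/-- **Integral decompositions of a fixed power approach the complex asymptotic rank**: for every
`δ > 0` there are `m ≥ 1` and an integral decomposition of `T_k^{⊗m}` of length
`R < (R̃_ℂ(T_k) + δ)^m` (rational decompositions, `exists_rat_decomposition_tripartitionTensor_pow`,
with all denominators cleared by their product). [cite: Pratt2024SCC, §2 (proof of Thm. 1.9)] -/
theorem exists_intDecomp (k : ℕ) {δ : ℝ} (hδ : 0 < δ) :
    ∃ m : ℕ, 1 ≤ m ∧ ∃ dec : IntDecomp k m,
      (dec.R : ℝ) < (asymptoticRank (tripartitionTensor ℂ k) + δ) ^ m := by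
  classical
  obtain ⟨m, hm, r, w, u, v, hdec, hr⟩ := exists_rat_decomposition_tripartitionTensor_pow k hδ
  -- common denominators of the three families of vectors
  let Dw : ℕ := ∏ p : Fin r × (Fin m → TripartitionIndex k), (w p.1 p.2).den
  let Du : ℕ := ∏ p : Fin r × (Fin m → TripartitionIndex k), (u p.1 p.2).den
  let Dv : ℕ := ∏ p : Fin r × (Fin m → TripartitionIndex k), (v p.1 p.2).den
  have hDw : ∀ i a, (w i a).den ∣ Dw := fun i a =>
    Finset.dvd_prod_of_mem (fun p : Fin r × (Fin m → TripartitionIndex k) => (w p.1 p.2).den)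
      (Finset.mem_univ (i, a))
  have hDu : ∀ i a, (u i a).den ∣ Du := fun i a =>
    Finset.dvd_prod_of_mem (fun p : Fin r × (Fin m → TripartitionIndex k) => (u p.1 p.2).den)
      (Finset.mem_univ (i, a))
  have hDv : ∀ i a, (v i a).den ∣ Dv := fun i a =>
    Finset.dvd_prod_of_mem (fun p : Fin r × (Fin m → TripartitionIndex k) => (v p.1 p.2).den)
      (Finset.mem_univ (i, a))
  have hDw0 : 0 < Dw := Finset.prod_pos fun p _ => (w p.1 p.2).den_pos
  have hDu0 : 0 < Du := Finset.prod_pos fun p _ => (u p.1 p.2).den_pos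
  have hDv0 : 0 < Dv := Finset.prod_pos fun p _ => (v p.1 p.2).den_pos
  refine ⟨m, hm, ⟨r, Dw * Du * Dv, by positivity,
    fun i a => clearDen Dw (w i a), fun i b => clearDen Du (u i b), fun i c => clearDen Dv (v i c),
    fun a b c => ?_⟩, hr⟩
  -- the identity, checked in `ℚ`
  have hq : ((kroneckerPow (tripartitionTensor ℤ k) m a b c : ℤ) : ℚ) =
      kroneckerPow (tripartitionTensor ℚ k) m a b c := by
    simp only [kroneckerPow_apply, Int.cast_prod, tripartitionTensor_apply]
    refine Finset.prod_congr rfl fun i _ => ?_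
    split_ifs <;> simp
  apply Int.cast_injective (α := ℚ)
  have hc := congrFun (congrFun (congrFun hdec a) b) c
  rw [sum_triad_apply] at hc
  simp only [Int.cast_mul, Int.cast_sum, Int.cast_natCast, Nat.cast_mul, cast_clearDen (hDw _ _),
    cast_clearDen (hDu _ _), cast_clearDen (hDv _ _), hq, hc, Finset.mul_sum]
  refine Finset.sum_congr rfl fun i _ => ?_
  ring

namespace IntDecomp

variable {k m : ℕ} (dec : IntDecomp k m)

/-- The first transform of an input `x` indexed by `j`-tuples: `X̂(ℓ) = ∑_s (∏_g α_{ℓ_g}(s_g)) x(s)`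
— what `j` rounds of mode products with the matrix `α` compute. [cite: Pratt2024SCC, §2 (proof of Thm. 1.9)] -/
def transformα (j : ℕ) (x : (Fin j → Fin m → TripartitionIndex k) → ℤ) (ℓ : Fin j → Fin dec.R) : ℤ :=
  ∑ s : Fin j → Fin m → TripartitionIndex k, (∏ g, dec.α (ℓ g) (s g)) * x s

/-- The second transform, with the matrix `β`. [cite: Pratt2024SCC, §2 (proof of Thm. 1.9)] -/
def transformβ (j : ℕ) (y : (Fin j → Fin m → TripartitionIndex k) → ℤ) (ℓ : Fin j → Fin dec.R) : ℤ :=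
  ∑ t : Fin j → Fin m → TripartitionIndex k, (∏ g, dec.β (ℓ g) (t g)) * y t

/-- The third transform, with the matrix `γ`. [cite: Pratt2024SCC, §2 (proof of Thm. 1.9)] -/
def transformγ (j : ℕ) (z : (Fin j → Fin m → TripartitionIndex k) → ℤ) (ℓ : Fin j → Fin dec.R) : ℤ :=
  ∑ u : Fin j → Fin m → TripartitionIndex k, (∏ g, dec.γ (ℓ g) (u g)) * z u

/-- The `j`-th Kronecker power of the decomposition identity, pointwise:
`∑_ℓ ∏_g α_{ℓ_g}(s_g) β_{ℓ_g}(t_g) γ_{ℓ_g}(u_g) = D₀^j ∏_g T_k^{⊗m}(s_g, t_g, u_g)`.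
[cite: BurgisserClausenShokrollahi1997, Prop. 15.17] -/
theorem sum_prod_eq (j : ℕ) (s t u : Fin j → Fin m → TripartitionIndex k) :
    ∑ ℓ : Fin j → Fin dec.R, ∏ g, dec.α (ℓ g) (s g) * dec.β (ℓ g) (t g) * dec.γ (ℓ g) (u g) =
      (dec.D₀ : ℤ) ^ j * ∏ g, kroneckerPow (tripartitionTensor ℤ k) m (s g) (t g) (u g) := by
  classical
  rw [← Fintype.prod_sum (fun g ℓ => dec.α ℓ (s g) * dec.β ℓ (t g) * dec.γ ℓ (u g))]
  simp_rw [← dec.eq]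
  rw [Finset.prod_mul_distrib, Finset.prod_const, Finset.card_univ, Fintype.card_fin]

/-- **The evaluation identity** (Pratt: evaluating the restriction of `T_k^{⊗r}` through a rank
decomposition of a fixed power): for integer inputs `x, y, z` indexed by `j`-tuples,
`∑_ℓ X̂(ℓ) Ŷ(ℓ) Ẑ(ℓ) = D₀^j · ∑_{s,t,u} (∏_g T_k^{⊗m}(s_g,t_g,u_g)) x(s) y(t) z(u)`.
With `0/1`-valued `x, y, z` the right-hand sum counts the blockwise tripartitions supported on
them. [cite: Pratt2024SCC, §2 (proof of Thm. 1.9)] -/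
theorem eval_pow (j : ℕ) (x y z : (Fin j → Fin m → TripartitionIndex k) → ℤ) :
    ∑ ℓ : Fin j → Fin dec.R, dec.transformα j x ℓ * dec.transformβ j y ℓ * dec.transformγ j z ℓ =
      (dec.D₀ : ℤ) ^ j * ∑ s : Fin j → Fin m → TripartitionIndex k,
        ∑ t : Fin j → Fin m → TripartitionIndex k, ∑ u : Fin j → Fin m → TripartitionIndex k,
          (∏ g, kroneckerPow (tripartitionTensor ℤ k) m (s g) (t g) (u g)) * (x s * y t * z u) := by
  classical
  -- expand the three transforms and exchange the order of summation
  have hexp : ∀ ℓ : Fin j → Fin dec.R,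
      dec.transformα j x ℓ * dec.transformβ j y ℓ * dec.transformγ j z ℓ =
        ∑ s : Fin j → Fin m → TripartitionIndex k, ∑ t : Fin j → Fin m → TripartitionIndex k,
          ∑ u : Fin j → Fin m → TripartitionIndex k,
            (∏ g, dec.α (ℓ g) (s g) * dec.β (ℓ g) (t g) * dec.γ (ℓ g) (u g)) * (x s * y t * z u) := by
    intro ℓ
    unfold transformα transformβ transformγ
    rw [Finset.sum_mul_sum]
    simp only [Finset.sum_mul, Finset.mul_sum]
    -- the sums come out in the order `u, s, t`; reorder to `s, t, u`
    rw [Finset.sum_comm]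
    refine Finset.sum_congr rfl fun s _ => ?_
    rw [Finset.sum_comm]
    refine Finset.sum_congr rfl fun t _ => Finset.sum_congr rfl fun u _ => ?_
    rw [Finset.prod_mul_distrib, Finset.prod_mul_distrib]
    ring
  simp_rw [hexp]
  rw [Finset.sum_comm]
  simp_rw [Finset.mul_sum]
  refine Finset.sum_congr rfl fun s _ => ?_
  rw [Finset.sum_comm]
  refine Finset.sum_congr rfl fun t _ => ?_
  rw [Finset.sum_comm]
  refine Finset.sum_congr rfl fun u _ => ?_
  rw [← Finset.sum_mul, dec.sum_prod_eq j s t u]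
  ring

end IntDecomp

end Literature.Computability.AlgebraicComplexity
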